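import Summits.QuantumFields.YangMills.Theorems.AlphaInputsT3ACv3NewtonLiftStencilRows
import Summits.QuantumFields.YangMills.Theorems.AlphaInputsT3ACv3StartTwoCellSat
import Summits.QuantumFields.YangMills.Theorems.AlphaInputsT3ACv3StartDefectTwoCellTgt
import HarnessLib

/-!
# `AlphaInputsT3ACv3StartPlaqWindow` — MAP #3 M22, the (FL) `hLift` clause for `16 ≤ L^k`: **THE PLAQUETTE WINDOW PRODUCT SET (§§1–3 of the plaquette chart)** — for a constrained finest plaquette `q = (z; μ, ν)` of a region `Ω`
# SATURATED at level `k`, the comb gauge from the centre of ANY of the three blocks `blk z`, `blk(z+e_μ)`, `blk(z+e_ν)` is `(d⌊L^k∕2⌋ + 2L^k)·δ`-FLAT on EACH of the four bonds of `q`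
# whenever the constrained plaquettes of `Ω` are within `δ` of `1` — including the 2×2 CORNER case (`z` on the far `μ`- and `ν`-faces of its block: corners in four blocks), which
# no two-cell product set charts.  The chart is the per-plaquette WINDOW product set `I_κ = {start_κ + u : u ≤ W_κ}`, `W_κ = 2L^k − 1` in a straddled direction `κ ∈ {μ, ν}` and
# `L^k − 1` otherwise: every site of `∏ I_κ` lies over the block of one of the four corners (so in `Ω`), and the comb fans from the three centres to the four bonds stay in `∏ I_κ`
# (★w1 g0's `dist1_gaugeActT_axialT_le_of_box`) — lane `pub-balaban3d` ∕ cell `ym3-torus`, seat `ym-ust-19936-w4` (g3); ★w4 g3 LOCATED 04:54Z (the row `hflatP` of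
# `hLift_clause_of_start`: (H)'s `hU₀P` and the kernel certificate's (δ) at the centre-anchored comb gauges)

WHAT (def-free).  §1 one-dimensional window arithmetic on `ZMod N` (`rel_eq_of_window`, `fan_mem_window`); §2 the offsets of the corners and the blocks of the corners
(`apply_eq_blockStart_add_mod`, `shift_apply_eq_blockStart_add`, `shift_shift_apply_eq_blockStart_add`, `iterBlockOf_apply_of_offset'`, `div_offset_eq`); §3 ★ `mem_of_window` (sites
of the window product set are in `Ω`), `window_lt_sitesPerDir`.  §4 (the row `hflatP` itself) is the sibling module `…StartPlaqChart`.
HONEST FRAMING.  Torus-label bookkeeping over ★w5 g2's two-cell charts and ★w1 g0's regional axial gauge; count-neutral helper toward R3 2′ (items 19936∕19935); `hLift`, the stub 2′χ,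
the crux `HistoryTailL` and any gap are NOT claimed; registry untouched; nothing about d = 4, the continuum, or a mass gap; YM₃ on T³ is rung R3, not Clay.

References: T. Bałaban, Commun. Math. Phys. 98 (1985) 17–51 [Balaban1985Averaging] ((8) p.18, (19) p.21, pp.24–25); CMP 109 (1987) 249–301 [Balaban1987RG1] ((0.1) p.251);
CMP 102 (1985) 277–309 [Balaban1985Variational] ((3) p.278, (18) p.280).
-/

set_option autoImplicit false

noncomputable section

open scoped Matrix.Norms.L2Operator

namespace Summit.QuantumFields.YangMills.Theorems.TubeStart

open Literature.MathematicalPhysics.QuantumFieldTheory.Balaban1983to89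
open T4Continuum
open B10Eq27TorusAxialLog (axialT gaugeActT rel rel_apply gaugeActT_eq_gaugeAct)
open B7Prop1Explicit (l1 e e_apply)
open Literature.MathematicalPhysics.QuantumFieldTheory.Balaban1983to89.B5Eq118OneStroke (iterBlockOf val_iterBlockOf)
open Literature.MathematicalPhysics.QuantumFieldTheory.Balaban1983to89.B10Eq38TorusDomains (toFine plaqsIn cornerSet mem_plaqsIn_iff)
open Summit.QuantumFields.YangMills.Theorems.StartDefectBox (blockStart toFine_src_eq_blockStart toFine_tgt_apply)
open Summit.QuantumFields.YangMills.Theorems.RegionAxialGauge (dist1_gaugeActT_axialT_le_of_box)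
open Summit.QuantumFields.YangMills.Theorems.PerturbedPlaquette (dist1_SU_eq)

/-! ## §1 One-dimensional window arithmetic -/

section OneDim

variable {N : ℕ}

/-- The torus difference of two labels of ONE window `{s + u : u ≤ W}` with `2W < N` is the integer difference of their offsets. [folklore] -/
theorem rel_eq_of_window [NeZero N] {y x s : ZMod N} {p a W : ℕ} (hy : y = s + ((p : ℕ) : ZMod N)) (hx : x = s + ((a : ℕ) : ZMod N)) (hp : p ≤ W) (ha : a ≤ W) (hW : 2 * W < N) :
    (x - y).valMinAbs = (a : ℤ) - p := by
  refine (ZMod.valMinAbs_spec _ _).mpr ⟨?_, ?_⟩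
  · rw [hx, hy, Int.cast_sub, Int.cast_natCast, Int.cast_natCast]; abel
  · constructor <;> omega

/-- **THE FAN STAYS IN THE WINDOW**: for offsets `p, a, a′ ≤ W` and every integer `t` between `0 ∧ (a − p) ∧ (a′ − p)` and `0 ∨ (a − p) ∨ (a′ − p)`, the label `s + p + t` is `s + u` with
`u ≤ W`. [folklore] -/
theorem fan_mem_window (s : ZMod N) {p a a' W : ℕ} (hp : p ≤ W) (ha : a ≤ W) (ha' : a' ≤ W) (t : ℤ)
    (ht1 : min 0 (min ((a : ℤ) - p) ((a' : ℤ) - p)) ≤ t) (ht2 : t ≤ max 0 (max ((a : ℤ) - p) ((a' : ℤ) - p))) :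
    ∃ u : ℕ, u ≤ W ∧ s + ((p : ℕ) : ZMod N) + ((t : ℤ) : ZMod N) = s + ((u : ℕ) : ZMod N) := by
  have hlo : 0 ≤ (p : ℤ) + t := by
    have : -(p : ℤ) ≤ min 0 (min ((a : ℤ) - p) ((a' : ℤ) - p)) := le_min (by omega) (le_min (by omega) (by omega))
    omega
  have hhi : (p : ℤ) + t ≤ W := by
    have : max 0 (max ((a : ℤ) - p) ((a' : ℤ) - p)) ≤ (W : ℤ) - p := max_le (by omega) (max_le (by omega) (by omega))
    omega
  refine ⟨((p : ℤ) + t).toNat, by omega, ?_⟩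
  rw [add_assoc, ← Int.cast_natCast (R := ZMod N) ((p : ℤ) + t).toNat, Int.toNat_of_nonneg hlo, Int.cast_add, Int.cast_natCast]

end OneDim

/-! ## §2 Offsets of fine sites and the blocks of shifted sites -/

section Offsets

variable {P : Params} {k : ℕ} (hk : k ≤ P.m + P.K)
include hk

/-- **THE OFFSET OF A FINE SITE IN ITS OWN BLOCK**: `z_κ = start_κ(blk z) + (z_κ mod L^k)`. [cite: Balaban1987RG1, (0.1) p.251] -/
theorem apply_eq_blockStart_add_mod (z : Site P 0) (α κ : Fin P.d) :
    z κ = blockStart k (⟨iterBlockOf k z, α⟩ : PBond P k) κ + ((((z κ).val % P.L ^ k : ℕ)) : ZMod (P.sitesPerDir 0)) := by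
  rw [blockStart, ← Nat.cast_add]
  show z κ = ((((iterBlockOf k z κ).val * P.L ^ k + (z κ).val % P.L ^ k : ℕ)) : ZMod (P.sitesPerDir 0))
  rw [val_iterBlockOf k hk z κ, Nat.div_add_mod' (z κ).val (P.L ^ k), ZMod.natCast_zmod_val]

/-- A shifted site's coordinates from the block start: `(z + e_μ)_κ = start_κ + ((z_κ mod L^k) + [κ = μ])`. [folklore] -/
theorem shift_apply_eq_blockStart_add (z : Site P 0) (α μ κ : Fin P.d) :
    (z.shift μ) κ = blockStart k (⟨iterBlockOf k z, α⟩ : PBond P k) κ + ((((z κ).val % P.L ^ k + (if κ = μ then 1 else 0) : ℕ)) : ZMod (P.sitesPerDir 0)) := by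
  by_cases hκ : κ = μ
  · subst hκ
    rw [B10StarCount.shift_apply_self, if_pos rfl, Nat.cast_add, Nat.cast_one, ← add_assoc, ← apply_eq_blockStart_add_mod hk z α κ]
  · rw [B10StarCount.shift_apply_ne _ hκ, if_neg hκ, add_zero, ← apply_eq_blockStart_add_mod hk z α κ]

/-- A doubly shifted site's coordinates from the block start (`μ ≠ ν`). [folklore] -/
theorem shift_shift_apply_eq_blockStart_add (z : Site P 0) (α : Fin P.d) {μ ν : Fin P.d} (hμν : μ ≠ ν) (κ : Fin P.d) :
    ((z.shift μ).shift ν) κ = blockStart k (⟨iterBlockOf k z, α⟩ : PBond P k) κ +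
      ((((z κ).val % P.L ^ k + (if κ = μ then 1 else 0) + (if κ = ν then 1 else 0) : ℕ)) : ZMod (P.sitesPerDir 0)) := by
  by_cases hκ : κ = ν
  · subst hκ
    rw [B10StarCount.shift_apply_self, shift_apply_eq_blockStart_add hk z α μ κ, if_neg (Ne.symm hμν), if_pos rfl]
    push_cast; ring
  · rw [B10StarCount.shift_apply_ne _ hκ, shift_apply_eq_blockStart_add hk z α μ κ, if_neg hκ, add_zero]

/-- **THE BLOCK LABEL FROM AN OFFSET** (★w1 g2's `iterBlockOf_apply_of_offset`, restated at the block of `z`): if `x_κ = start_κ(blk z) + a` then `(blk x)_κ = (blk z)_κ + ⌊a∕L^k⌋`.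
[cite: Balaban1987RG1, (0.1) p.251] -/
theorem iterBlockOf_apply_of_offset' (z x : Site P 0) (α κ : Fin P.d) {a : ℕ}
    (hx : x κ = blockStart k (⟨iterBlockOf k z, α⟩ : PBond P k) κ + ((a : ℕ) : ZMod (P.sitesPerDir 0))) :
    iterBlockOf k x κ = iterBlockOf k z κ + (((a / P.L ^ k : ℕ) : ℕ) : ZMod (P.sitesPerDir k)) :=
  iterBlockOf_apply_of_offset hk ⟨iterBlockOf k z, α⟩ x κ hx

omit hk in
/-- `(r + j)∕L^k` for `r < L^k`, `j ≤ 1`: it is `1` iff `j = 1 ∧ r = L^k − 1`, else `0`. [folklore] -/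
theorem div_offset_eq (r j : ℕ) (hr : r < P.L ^ k) (hj : j ≤ 1) : (r + j) / P.L ^ k = if j = 1 ∧ r = P.L ^ k - 1 then 1 else 0 := by
  have hpos : 0 < P.L ^ k := pow_pos P.L_pos k
  split_ifs with h
  · obtain ⟨rfl, rfl⟩ := h
    rw [Nat.sub_add_cancel hpos, Nat.div_self hpos]
  · refine Nat.div_eq_of_lt ?_
    rcases Nat.le_one_iff_eq_zero_or_eq_one.mp hj with rfl | rfl
    · omega
    · have : r ≠ P.L ^ k - 1 := fun e => h ⟨rfl, e⟩
      omega

end Offsets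

/-! ## §3 The window product set of a constrained plaquette lies in `Ω` -/

section Window

variable {P : Params} {k : ℕ} (hk : k ≤ P.m + P.K) (hN4 : 4 * P.L ^ k ≤ P.sitesPerDir 0)
include hk

/-- **★ SITES OF THE PLAQUETTE's WINDOW PRODUCT SET ARE IN `Ω`** (Ω saturated at level `k`, `q` constrained).  With `z = q₋`, `r_κ = z_κ mod L^k`, `start = start(blk z)` and the windows
`W_κ = 2L^k − 1` if `κ ∈ {μ, ν}` and `r_κ = L^k − 1` (straddle), `L^k − 1` otherwise: every fine site `w` with `w_κ = start_κ + u_κ`, `u_κ ≤ W_κ`, lies over the block of one of the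
four corners of `q`, hence in `Ω`. [cite: Balaban1985Variational, (3) p.278; Balaban1987RG1, (0.1) p.251] -/
theorem mem_of_window {Ω : Set (Site P 0)} (hsat : ∀ x : Site P 0, x ∈ Ω ↔ toFine k (iterBlockOf k x) ∈ Ω) (q : Plaq P 0) (hq : q ∈ plaqsIn 0 Ω) (w : Site P 0)
    (hw : ∀ κ, ∃ u : ℕ, u ≤ (if (κ = q.μ ∨ κ = q.ν) ∧ (q.src κ).val % P.L ^ k = P.L ^ k - 1 then 2 * P.L ^ k - 1 else P.L ^ k - 1) ∧
      w κ = blockStart k (⟨iterBlockOf k q.src, q.μ⟩ : PBond P k) κ + ((u : ℕ) : ZMod (P.sitesPerDir 0))) : w ∈ Ω := by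
  have hpos : 0 < P.L ^ k := pow_pos P.L_pos k
  have hμν : q.μ ≠ q.ν := ne_of_lt q.hμν
  -- the four corners are in Ω
  have hc := mem_plaqsIn_iff.1 hq
  simp only [cornerSet, Set.insert_subset_iff, Set.singleton_subset_iff, B10Eq38TorusDomains.toFine_zero] at hc
  obtain ⟨h1, h2, h3, h4⟩ := hc
  choose u hu using hw
  -- the cell jumps `j_κ = ⌊u_κ∕L^k⌋ ∈ {0, 1}`, `= 1` only in a straddled plaquette direction
  have hj : ∀ κ, u κ / P.L ^ k ≤ 1 ∧ (u κ / P.L ^ k = 1 → (κ = q.μ ∨ κ = q.ν) ∧ (q.src κ).val % P.L ^ k = P.L ^ k - 1) := by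
    intro κ
    have h := (hu κ).1
    split_ifs at h with hs
    · refine ⟨?_, fun _ => hs⟩
      exact Nat.lt_succ_iff.mp ((Nat.div_lt_iff_lt_mul hpos).2 (by omega))
    · have : u κ / P.L ^ k = 0 := Nat.div_eq_of_lt (by omega)
      rw [this]; exact ⟨by omega, fun h => absurd h (by omega)⟩
  have hblk : ∀ κ, iterBlockOf k w κ = iterBlockOf k q.src κ + (((u κ / P.L ^ k : ℕ) : ℕ) : ZMod (P.sitesPerDir k)) :=
    fun κ => iterBlockOf_apply_of_offset' hk q.src w q.μ κ (hu κ).2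
  -- the corner with the same cell jumps
  have hr : ∀ κ, (q.src κ).val % P.L ^ k < P.L ^ k := fun κ => Nat.mod_lt _ hpos
  have key : ∀ x : Site P 0, x ∈ Ω → (∀ κ, iterBlockOf k x κ = iterBlockOf k q.src κ + (((u κ / P.L ^ k : ℕ) : ℕ) : ZMod (P.sitesPerDir k))) → w ∈ Ω := by
    intro x hx hxb
    have e : iterBlockOf k w = iterBlockOf k x := funext fun κ => by rw [hblk, hxb]
    rw [hsat w, e]; exact (hsat x).1 hx
  -- offsets of the corners: `(r_κ + l_κ)∕L^k = l_κ` when `l_κ = 1` forces the straddle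
  have hcorner : ∀ (lμ lν : ℕ), lμ = u q.μ / P.L ^ k → lν = u q.ν / P.L ^ k → ∀ κ,
      ((q.src κ).val % P.L ^ k + (if κ = q.μ then lμ else 0) + (if κ = q.ν then lν else 0)) / P.L ^ k = u κ / P.L ^ k := by
    intro lμ lν hlμ hlν κ
    by_cases hκμ : κ = q.μ
    · subst hκμ
      rw [if_pos rfl, if_neg hμν, add_zero, div_offset_eq _ _ (hr _) (by rw [hlμ]; exact (hj _).1), ← hlμ]
      by_cases h1 : lμ = 1
      · rw [if_pos ⟨h1, ((hj _).2 (hlμ ▸ h1)).2⟩, h1]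
      · have h0 : lμ = 0 := by have := (hj q.μ).1; omega
        rw [h0, if_neg (by omega)]
    · by_cases hκν : κ = q.ν
      · subst hκν
        rw [if_neg hκμ, if_pos rfl, add_zero, div_offset_eq _ _ (hr _) (by rw [hlν]; exact (hj _).1), ← hlν]
        by_cases h1 : lν = 1
        · rw [if_pos ⟨h1, ((hj _).2 (hlν ▸ h1)).2⟩, h1]
        · have h0 : lν = 0 := by have := (hj q.ν).1; omega
          rw [h0, if_neg (by omega)]
      · rw [if_neg hκμ, if_neg hκν, add_zero, add_zero, Nat.div_eq_of_lt (hr κ)]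
        have h0 : u κ / P.L ^ k = 0 := by
          rcases Nat.le_one_iff_eq_zero_or_eq_one.mp (hj κ).1 with h | h
          · exact h
          · exact absurd ((hj κ).2 h).1 (fun h' => h'.elim hκμ hκν)
        rw [h0]
  -- case analysis on the two jumps
  rcases Nat.le_one_iff_eq_zero_or_eq_one.mp (hj q.μ).1 with hμ0 | hμ1 <;> rcases Nat.le_one_iff_eq_zero_or_eq_one.mp (hj q.ν).1 with hν0 | hν1
  · refine key q.src h1 fun κ => ?_
    rw [← hcorner 0 0 hμ0.symm hν0.symm κ]
    refine iterBlockOf_apply_of_offset' hk q.src q.src q.μ κ ?_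
    simpa using apply_eq_blockStart_add_mod hk q.src q.μ κ
  · refine key (q.src.shift q.ν) h3 fun κ => ?_
    rw [← hcorner 0 1 hμ0.symm hν1.symm κ]
    refine iterBlockOf_apply_of_offset' hk q.src _ q.μ κ ?_
    simpa using shift_apply_eq_blockStart_add hk q.src q.μ q.ν κ
  · refine key (q.src.shift q.μ) h2 fun κ => ?_
    rw [← hcorner 1 0 hμ1.symm hν0.symm κ]
    refine iterBlockOf_apply_of_offset' hk q.src _ q.μ κ ?_
    simpa using shift_apply_eq_blockStart_add hk q.src q.μ q.μ κ
  · refine key ((q.src.shift q.μ).shift q.ν) h4 fun κ => ?_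
    rw [← hcorner 1 1 hμ1.symm hν1.symm κ]
    exact iterBlockOf_apply_of_offset' hk q.src _ q.μ κ (shift_shift_apply_eq_blockStart_add hk q.src q.μ hμν κ)

include hN4

/-- **THE WINDOW IS SHORT**: `2·W_κ < sitesPerDir 0` and `(W_κ + 1)·2 ≤ sitesPerDir 0` (`4L^k ≤ sitesPerDir 0`). [folklore] -/
theorem window_lt_sitesPerDir (W : ℕ) (hW : W ≤ 2 * P.L ^ k - 1) : 2 * W < P.sitesPerDir 0 ∧ ((W : ℤ) + 1) * 2 ≤ (P.sitesPerDir 0 : ℤ) := by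
  have hpos : 0 < P.L ^ k := pow_pos P.L_pos k
  have _h := hk
  constructor <;> omega

end Window

end Summit.QuantumFields.YangMills.Theorems.TubeStart

end
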